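import Summits.CriticalPhenomena.Ising3DConformalLimit.Theses.OctaveForgetting

/-!
# OctaveForgetting — assembly glue (item stmt-CriticalPhenomena-14566)

The chain of route `OctaveForgetting` as one implication, pure logic:
SphereForgetting → ForgettingComposes → SphereCovarianceLowerBound → SphereVarianceUpperBound →
EtaFromForgetting2 → GaussianLimitIsFree → DeltaLowerBound → MoebiusLimit →
`Ising3DConformalLimit`.

Proof: `EtaFromForgetting2` fed the four sphere statements (its hypotheses are, verbatim, the
bodies of `ForgettingComposes`, `SphereCovarianceLowerBound`, `SphereVarianceUpperBound`) gives
`Target`, i.e. `κ > 0`, `C` with `G(x) ≤ C‖x‖^{-(1+κ)}`; take `(ρ, Δ, S)` from `MoebiusLimit`;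
if clause (iii) `HasNontrivialU4 S` failed, `GaussianLimitIsFree` (translation invariance and
scale covariance read off `IsMoebiusCovariant`) gives `Δ = 1/2`, while `DeltaLowerBound` with
`a := 1 + κ` gives `1 + κ ≤ 2Δ = 1`, contradicting `κ > 0`.
-/

namespace Summit.CriticalPhenomena.Ising3DConformalLimit.Theorems

/-- **Assembly glue of route OctaveForgetting** (item stmt-CriticalPhenomena-14566): the
implication SphereForgetting → ForgettingComposes → SphereCovarianceLowerBound →
SphereVarianceUpperBound → EtaFromForgetting2 → GaussianLimitIsFree → DeltaLowerBound →
MoebiusLimit → `Ising3DConformalLimit`, by pure logic plus one `linarith`: the glue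
`EtaFromForgetting2` turns the four sphere statements into the power-law bound `Target`
(`κ > 0`); the `MoebiusLimit` witness `(ρ, Δ, S)` supplies clauses (i)–(ii) of the conjunct, and
clause (iii) `U₄ ≢ 0` holds because otherwise `GaussianLimitIsFree` forces `Δ = 1/2` while
`DeltaLowerBound` (with `a := 1 + κ`) forces `1 + κ ≤ 2Δ`. [folklore] -/
theorem octaveForgetting_assembly_proof :
    Summit.CriticalPhenomena.Ising3DConformalLimit.Theses.OctaveForgetting.Assembly := by
  unfold Summit.CriticalPhenomena.Ising3DConformalLimit.Theses.OctaveForgetting.Assembly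
  intro hSF hFC hSCLB hSVUB hEta hGLF hDLB hML
  -- the glue item gives the Target: κ > 0 and C with G(x) ≤ C‖x‖^{-(1+κ)} for x ≠ 0
  obtain ⟨κ, C, hκ, hb⟩ := hEta hSF hFC hSCLB hSVUB
  obtain ⟨ρ, Δ, S, hρ, hΔ, hlim, hnd, hM⟩ := hML
  refine ⟨ρ, Δ, S, hρ, hΔ, hlim, hnd, hM, ?_⟩
  -- clause (iii) by contradiction: suppose U₄ ≡ 0 on non-coincident configurations
  by_contra hU
  have h1 : Δ = 1 / 2 := hGLF ρ Δ S hρ hlim hnd hM.1.1 hM.2.1 hU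
  have h2 : 1 + κ ≤ 2 * Δ := hDLB (1 + κ) C ρ Δ S hb hρ hlim hnd hM.2.1
  linarith

end Summit.CriticalPhenomena.Ising3DConformalLimit.Theorems
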